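import Literature.Barriers.QuantumAdvantage.FFKLCertificateBound
import Literature.Barriers.QuantumAdvantage.CohenGenericJoinPH
import Literature.Computability.Complexity.CertificateAlgorithm
import Literature.Computability.Complexity.PlumbingBricks
import HarnessLib

/-!
# A relativized world with `P = BQP = AWPP` and an infinite polynomial-time hierarchy: a brain oracle joined with a Cohen generic (discharge of `fortnowRogers1999_cor37`)

Proof file (D-0014: theorems and concrete definitions only) for the named fact
`Literature.Barriers.QuantumAdvantage.fortnowRogers1999_cor37` (`SupremacyTheoremsNonRelativizing.lean`):
Fortnow–Rogers, *Complexity limitations on quantum computation*, JCSS 59 (1999), **Cor. 3.7**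
(arXiv numbering, p. 5): "There exists a relativized world where `P = BQP` and the polynomial-time
hierarchy is infinite", typed `∃ A, P^A = BQP^A ∧ ∀ k, Σₖ^A ≠ Σₖ₊₁^A`.

**The printed proof** (p. 5): Thm. 3.6 (Fenner–Fortnow–Kurtz–Li; Nisan–Szegedy) "If `P = PSPACE`
(unrelativized) then `P^G = AWPP^G` for any generic `G`"; "We can create an oracle `H` by starting
with an oracle making `P = PSPACE` and joining a generic `G` to that. Because the polynomial-time
hierarchy is infinite relative to generic oracles and because Theorem 3.1 [`BQP ⊆ AWPP`]
relativizes, we can get some interesting relativized worlds." The tree has every ingredient but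
one: `BPP^A ⊆ BQP^A ⊆ AWPP^A` (`uniformOracleCoinSimulation_holds`, `BQPRel_subset_AWPPRel_holds`),
the hierarchy relative to `B ⊕ G` for Cohen generic `G` and EVERY base `B`
(`isInfinitePHRel_join_generic_holds`), the genericity layer of Fenner–Fortnow–Kurtz–Li's collapse
for every base `B` (`FFKL.PRel_eq_AWPPRel_of_isGeneric_of_stdAlg`, `FFKLGenericCollapse.lean`:
`P^{B ⊕ G} = AWPP^{B ⊕ G}` for `FFKL.family B`-generic `G` GIVEN that the language of every
well-formed `AWPP^{B ⊕ ·}` description categorical over a finite condition `σ` is in `P^{B ⊕ G}`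
for all `G` extending `σ` — the Standard Algorithm, Fig. 1 / Lemma 6.16), and the certificate
bounds of Thm. 6.13 for such descriptions (`FFKLCertificateBound.lean`). The missing ingredient is
the COMPUTATIONAL POWER running the Standard Algorithm: in print `F_j ∈ FPSPACE` (Lemma 6.17)
relative to a `PSPACE`-complete `B` — the named fact `fennerFortnowKurtzLi2003_thm618_awpp`,
a `PSPACE`-machine formalization.

**This file proves Cor. 3.7 with the base oracle replaced by a brain.** Cor. 3.7 asks for SOME
world; the printed architecture goes through verbatim for `A = K ⊕ G` where `K` is not a
`PSPACE`-complete set but a *self-encoding brain oracle* (Ko 1989, §5; the device of the tree's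
proof of Fortnow–Rogers' Thm. 4.2, `FortnowRogersBrain.lean`): `K` answers, one bit per round, the
questions of the oracle-driven protocol machine of `Complexity/BrainProtocol.lean`, and its answers
at a question of length `L` depend only on `K` below `L` (`FRO.build`, recursion on length), which
is all the machines of a description can read when the payload is padded beyond their reach. The
brain of an instance `(Δ, σ, x)` WALKS THE DECISION TREE of Nisan's certificate-search algorithm
(Beals et al. Lemma 5.3, the tree's `CertificateAlgorithm.roundTree` — the Standard Algorithm with
the certificates supplied by the brain instead of by `F_j`) for the window function
`f = Δ.certFn K σ x` of Thm. 6.13: each probe is a window string of `G`, the verdict is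
`f(G|window) = [x ∈ L(Δ^{K ⊕ G})]`, and for `Δ` categorical over `σ` the walk has depth
`≤ bs(f)·C(f) ≤ 4d² · 16d⁴` (Thm. 6.13 via Nisan–Szegedy, `blockSensitivity_certFn_le`,
`certificateComplexity_certFn_le`), a polynomial in `|x|`. So the Standard-Algorithm hypothesis of
`FFKLGenericCollapse.lean` holds for the base `K` (`Cor37Brain.stdAlg_oracleK`) with no complexity
bound on `K` whatsoever; a single `G` generic for the union of the (countable) collapse family
`FFKL.family K` and the hierarchy family of `K` then gives `P^{K ⊕ G} = AWPP^{K ⊕ G}` with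
`PH^{K ⊕ G}` infinite (`Cor37Brain.exists_generic_world`), and the tree's assembly
`fortnowRogers1999_cor37_of_parts` closes **`fortnowRogers1999_cor37_holds`**.

Main declarations (`namespace Cor37Brain`):

* `TreeWalk.walk`, `TreeWalk.brain` — the brain that walks a decision tree along the recorded
  probe answers; `TreeWalk.walk_results`, `TreeWalk.brain_halts` (after `depth` probes it halts
  with the tree's value on the hidden input);
* `Descr` (a well-formed description with a condition; countable), `tagStr`, `pay`/`payFn` (the padded
  payload, in `FP`), `lvl` (the truncation level), `plan` (the brain of an instance), `KHolds`,
  `oracleK` (the brain oracle), `mem_oracleK_question_iff` (the fixed-point equation at questions);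
* `AWPPDescr.gap_congr_base`, `AWPPDescr.certFn_congr_base` (well-formed descriptions do not see
  the base above their reach);
* `mem_lang_iff_mem_protoLang`, `lang_mem_PRel`, **`stdAlg_oracleK`**, **`exists_generic_world`**,
  `PRel_eq_BQPRel_infinitePH`; and, in the barrier namespace, **`fortnowRogers1999_cor37_holds`**.

## Design notes

* The statement proved is the tree's `fortnowRogers1999_cor37` verbatim (`∃ A, P^A = BQP^A ∧ PH^A`
  infinite); only the witness differs from the printed one (`K ⊕ G` instead of `H ⊕ G`). The
  general published collapse for a `PSPACE`-complete base — the named fact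
  `fennerFortnowKurtzLi2003_thm618_awpp` of `FortnowRogersOracle.lean` — is neither used nor
  restated here; when it lands, `fortnowRogers1999_cor37_of₁` gives a second proof.
* No complexity bound on `K` is needed or claimed: the protocol machine is polynomial-time relative
  to `K ⊕ G` (`protoLang_mem_PRel`), and all the "thinking" is in the (noncomputable) rule `KHolds`.
  Categoricity of the description over `σ` is used exactly once, for the DEPTH of the walk
  (Thm. 6.13); the verdict is right for every description (a decision tree computes its function).
* Self-reference (the machines of a description query `K`, whose answers describe their runs) is
  cut by length, as in `FortnowRogersBrain.lean`: the payload `⟨tag, ⟨x, 1^{P(|x|)}⟩⟩` makes every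
  question longer than `P(|x|) ≥ d(x)`, the brain computes with the base `K_{<P(|x|)+1}`, and a
  well-formed description cannot tell `K_{<P(|x|)+1} ⊕ Z` from `K ⊕ Z` on the witnesses of `x`
  (`AWPPDescr.certFn_congr_base`).
* `Cor37Brain.instCountableCohenCondition` (conditions are countable, via their finite graphs) is
  the only instance declared; tags are any injection `Descr → ℕ` written in unary.

## References

* [FortnowRogers1999JCSS] L. Fortnow, J. Rogers, JCSS 59 (1999) (arXiv:cs/9811023, held; read via
  `lit read arxiv:cs/9811023 --pages 5`): Thm. 3.1, Thm. 3.6, Cor. 3.7 and the paragraph between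
  them (p. 5); Thm. 4.2 (p. 7, the join `H ⊕ G`).
* [FennerFortnowKurtzLi2003IC] S. Fenner, L. Fortnow, S. Kurtz, L. Li, *An oracle builder's
  toolkit*, Inform. and Comput. 182 (2003) (read via `lit read doi:10.1016/s0890-5401(03)00018-x
  --pages 25-34`): Lemma 6.8 and Fig. 1 (the Standard Algorithm, pp. 28–29), Lemma 6.9, Thm. 6.11
  (Nisan–Szegedy), Lemma 6.12, Thm. 6.13 (pp. 30–32), §6.5, Lemma 6.16, Lemma 6.17, Thm. 6.18 (2)
  and the rerelativization remark (pp. 32–34).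
* [Ko1989] K.-I Ko, *Constructing oracles by lower bound techniques for circuits* (1989), §5
  (self-encoding oracles depending only on shorter strings), as used in `FortnowRogersBrain.lean`.
* [BealsEtAl2001] R. Beals et al., *Quantum lower bounds by polynomials*, J. ACM 48 (2001),
  Lemma 5.3 (the certificate-search decision tree), the tree's `CertificateAlgorithm.lean`.
-/

noncomputable section

namespace Literature.Barriers.QuantumAdvantage

open _root_.Computability Literature.Computability.Complexity Literature.Computability.Complexity.Classes
  Literature.Computability.Complexity.CohenCondition Literature.Computability.Cryptography
  Literature.Computability.QuantumComplexity Literature.Computability.Complexity.BrainProtocol Finset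

/-! ### Well-formed descriptions do not see the base oracle above their reach -/

namespace AWPPDescr

variable {Δ : AWPPDescr}

/-- Two language oracles answer a query alike when membership agrees. [folklore] -/
theorem ofLanguage_eq_of_iff {A A' : Language Bool} {s : List Bool} (h : s ∈ A' ↔ s ∈ A) :
    Oracle.ofLanguage A' s = Oracle.ofLanguage A s := by
  rw [Oracle.ofLanguage_apply, Oracle.ofLanguage_apply]
  by_cases hs : s ∈ A'
  · rw [(Set.mem_iff_boolIndicator _ _).1 hs, (Set.mem_iff_boolIndicator _ _).1 (h.1 hs)]
  · rw [(Set.notMem_iff_boolIndicator _ _).1 hs,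
      (Set.notMem_iff_boolIndicator _ _).1 fun h' => hs (h.2 h')]

/-- Joins with bases agreeing on a string agree on the query `0·` of that string, and on all other
queries. [cite: FortnowRogers1999JCSS, proof of Thm. 4.2 (p. 7, the join H ⊕ G)] -/
theorem mem_oracleJoin_iff_of_base {B B' Z : Language Bool} {s : List Bool}
    (h : ∀ c, s = false :: c → (c ∈ B' ↔ c ∈ B)) : s ∈ oracleJoin B' Z ↔ s ∈ oracleJoin B Z := by
  rcases s with _ | ⟨b, c⟩
  · simp
  · cases b
    · rw [false_cons_mem_oracleJoin, false_cons_mem_oracleJoin]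
      exact h c rfl
    · rw [true_cons_mem_oracleJoin, true_cons_mem_oracleJoin]

/-- **Base congruence of the gap.** For a well-formed description, the gap at `x` relative to
`B ⊕ Z` only depends on the strings of the base `B` of length `< d(x)`: the machines on the
witnesses of `x` ask queries of length at most their fuel `≤ d(x)`, so a base query `0c` has
`|c| < d(x)` (runs are determined by the answers to the queries asked, `OracleAlg.run_congr`).
[cite: FennerFortnowKurtzLi2003IC, §6.4 (p. 31, "the length of each oracle query is also bounded by nᵏ")] -/
theorem gap_congr_base (hwf : Δ.WellFormed) {B B' : Language Bool} (Z : Language Bool) (x : List Bool)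
    (h : ∀ c : List Bool, c.length < Δ.certDeg x → (c ∈ B' ↔ c ∈ B)) :
    Δ.gap B' Z x = Δ.gap B Z x := by
  classical
  have h1 : ∀ y : List.Vector Bool (Δ.r₁.eval x.length),
      (boolPair x y.toList ∈ {z | Δ.acc₁ B' Z z} ↔ boolPair x y.toList ∈ {z | Δ.acc₁ B Z z}) := by
    intro y
    simp only [Set.mem_setOf_eq, AWPPDescr.acc₁]
    rw [OracleAlg.run_congr Δ.M₁ (O := Oracle.ofLanguage (oracleJoin B Z))
      (O' := Oracle.ofLanguage (oracleJoin B' Z)) fun s hs => ofLanguage_eq_of_iff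
        (mem_oracleJoin_iff_of_base fun c hc => h c ?_)]
    have hlen := (hwf.2.2.1 (Oracle.ofLanguage (oracleJoin B Z)) (boolPair x y.toList)).2 s hs
    rw [Δ.eval_length_boolPair_eq_certFuel₁ x y, hc, List.length_cons] at hlen
    exact lt_of_lt_of_le (Nat.lt_of_succ_le hlen) (le_max_left _ _)
  have h2 : ∀ y : List.Vector Bool (Δ.r₂.eval x.length),
      (boolPair x y.toList ∈ {z | Δ.acc₂ B' Z z} ↔ boolPair x y.toList ∈ {z | Δ.acc₂ B Z z}) := by
    intro y
    simp only [Set.mem_setOf_eq, AWPPDescr.acc₂]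
    rw [OracleAlg.run_congr Δ.M₂ (O := Oracle.ofLanguage (oracleJoin B Z))
      (O' := Oracle.ofLanguage (oracleJoin B' Z)) fun s hs => ofLanguage_eq_of_iff
        (mem_oracleJoin_iff_of_base fun c hc => h c ?_)]
    have hlen := (hwf.2.2.2 (Oracle.ofLanguage (oracleJoin B Z)) (boolPair x y.toList)).2 s hs
    rw [Δ.eval_length_boolPair_eq_certFuel₂ x y, hc, List.length_cons] at hlen
    exact lt_of_lt_of_le (Nat.lt_of_succ_le hlen) (le_max_right _ _)
  simp only [AWPPDescr.gap, AWPPDescr.cnt₁, AWPPDescr.cnt₂, AWPPDescr.countWitnesses_congr h1,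
    AWPPDescr.countWitnesses_congr h2]

/-- **Base congruence of the window function**: for a well-formed `Δ`, the window function of `x`
over `σ` is the same for two bases agreeing below `d(x)`. [cite: FennerFortnowKurtzLi2003IC, Thm. 6.13 (proof, pp. 31–32)] -/
theorem certFn_congr_base (hwf : Δ.WellFormed) {B B' : Language Bool} (σ : CohenCondition) (x : List Bool)
    (h : ∀ c : List Bool, c.length < Δ.certDeg x → (c ∈ B' ↔ c ∈ B)) :
    Δ.certFn B' σ x = Δ.certFn B σ x := by
  funext u
  unfold AWPPDescr.certFn
  have hiff : x ∈ Δ.lang B' (Δ.certOracle σ x u) ↔ x ∈ Δ.lang B (Δ.certOracle σ x u) := by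
    change 2 * (2 : ℤ) ^ Δ.p.eval x.length ≤ 3 * Δ.gap B' (Δ.certOracle σ x u) x ↔
      2 * (2 : ℤ) ^ Δ.p.eval x.length ≤ 3 * Δ.gap B (Δ.certOracle σ x u) x
    rw [gap_congr_base hwf _ x h]
  exact boolIndicator_eq_of_iff hiff

end AWPPDescr

namespace Cor37Brain

/-! ### Walking a decision tree along probe answers -/

namespace TreeWalk

open DecisionTree

variable {N : ℕ}

/-- Follow the recorded answers down the tree (the strings probed are ignored: on the canonical run
they are the variables of the nodes passed). [cite: BealsEtAl2001, Lemma 5.3 (proof: the algorithm as a decision tree)] -/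
def walk : List (List Bool × Bool) → DecisionTree N → DecisionTree N
  | [], t => t
  | _ :: _, leaf b => leaf b
  | (_, a) :: R, query _ t₀ t₁ => walk R (if a then t₁ else t₀)

/-- One step down the tree along the hidden input `x`. [folklore] -/
def step (x : Fin N → Bool) : DecisionTree N → DecisionTree N
  | leaf b => leaf b
  | query i t₀ t₁ => if x i then t₁ else t₀

/-- **The brain that walks the tree** `t`: probe the string of the variable at the current node,
halt with the label at a leaf. [cite: FennerFortnowKurtzLi2003IC, Fig. 1 (p. 29, the Standard Algorithm)] -/
def brain (str : Fin N → List Bool) (t : DecisionTree N) (R : List (List Bool × Bool)) : Action :=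
  match walk R t with
  | leaf b => .halt b
  | query i _ _ => .probe (str i)

/-- Walking from a leaf stays at the leaf. [folklore] -/
@[simp] theorem walk_leaf (R : List (List Bool × Bool)) (b : Bool) : walk R (leaf b : DecisionTree N) = leaf b := by
  cases R with
  | nil => rfl
  | cons p R => rfl

/-- Walking one more answer. [folklore] -/
theorem walk_append_singleton (R : List (List Bool × Bool)) (p : List Bool × Bool) (t : DecisionTree N) :
    walk (R ++ [p]) t = walk [p] (walk R t) := by
  induction R generalizing t with
  | nil => rfl
  | cons q R ih =>
    cases t with
    | leaf b => simp
    | query i t₀ t₁ =>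
      obtain ⟨s, a⟩ := q
      simp only [List.cons_append, walk]
      exact ih _

/-- Stepping from a leaf stays at the leaf. [folklore] -/
@[simp] theorem iterate_step_leaf (x : Fin N → Bool) (k : ℕ) (b : Bool) :
    (step x)^[k] (leaf b : DecisionTree N) = leaf b := by
  induction k with
  | zero => rfl
  | succ k ih => rw [Function.iterate_succ_apply, show step x (leaf b) = leaf b from rfl, ih]

/-- A step preserves the value on the hidden input. [folklore] -/
theorem eval_step (x : Fin N → Bool) (t : DecisionTree N) : (step x t).eval x = t.eval x := by
  cases t with
  | leaf b => rfl
  | query i t₀ t₁ =>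
    simp only [step, eval_query]
    split <;> rfl

/-- Steps preserve the value on the hidden input. [folklore] -/
theorem eval_iterate_step (x : Fin N → Bool) (k : ℕ) (t : DecisionTree N) : ((step x)^[k] t).eval x = t.eval x := by
  induction k generalizing t with
  | zero => rfl
  | succ k ih => rw [Function.iterate_succ_apply, ih, eval_step]

/-- **After `depth` steps the walk along `x` sits at a leaf**, labelled by the value of the tree.
[cite: BealsEtAl2001, Lemma 5.3 (proof)] -/
theorem iterate_step_eq_leaf (x : Fin N → Bool) :
    ∀ (t : DecisionTree N) (k : ℕ), t.depth ≤ k → (step x)^[k] t = leaf (t.eval x)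
  | leaf b, k, _ => by simp
  | query i t₀ t₁, k, hk => by
    obtain ⟨k, rfl⟩ : ∃ k', k = k' + 1 := ⟨k - 1, by rw [depth_query] at hk; omega⟩
    rw [depth_query] at hk
    rw [Function.iterate_succ_apply, eval_query]
    simp only [step]
    cases x i
    · simpa using iterate_step_eq_leaf x t₀ k (by have := le_max_left t₀.depth t₁.depth; omega)
    · simpa using iterate_step_eq_leaf x t₁ k (by have := le_max_right t₀.depth t₁.depth; omega)

variable (str : Fin N → List Bool) (t : DecisionTree N) {g : List Bool → Bool} {x : Fin N → Bool}

/-- A probe of the walking brain is the string of a variable. [folklore] -/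
theorem exists_eq_str_of_brain_eq_probe {R : List (List Bool × Bool)} {z : List Bool}
    (h : brain str t R = .probe z) : ∃ i, z = str i := by
  unfold brain at h
  split at h
  · cases h
  · cases h
    exact ⟨_, rfl⟩

/-- **The canonical run of the walking brain follows the hidden input**: when the probe of `str i`
is answered by `x i`, after `J` probes the walk sits where `J` steps along `x` lead.
[cite: FennerFortnowKurtzLi2003IC, Fig. 1 and Lemma 6.9 (p. 29)] -/
theorem walk_results (hg : ∀ i, g (str i) = x i) :
    ∀ J : ℕ, walk (results (brain str t) g J) t = (step x)^[J] t
  | 0 => by simp [results, walk]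
  | J + 1 => by
    have ih := walk_results hg J
    rw [Function.iterate_succ_apply', ← ih]
    cases hq : walk (results (brain str t) g J) t with
    | leaf b =>
      have hp : brain str t (results (brain str t) g J) = .halt b := by simp [brain, hq]
      rw [results_succ_of_halt g hp, hq]
      rfl
    | query i t₀ t₁ =>
      have hp : brain str t (results (brain str t) g J) = .probe (str i) := by simp [brain, hq]
      rw [results_succ_of_probe g hp, walk_append_singleton, hq, hg i]
      simp only [walk, step]

/-- **The walking brain halts after `depth` probes with the value of the tree on the hidden input.**
[cite: FennerFortnowKurtzLi2003IC, Lemma 6.9 (p. 29)] [cite: BealsEtAl2001, Lemma 5.3 (proof)] -/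
theorem brain_halts (hg : ∀ i, g (str i) = x i) :
    brain str t (results (brain str t) g t.depth) = .halt (t.eval x) := by
  have h := walk_results str t hg t.depth
  rw [iterate_step_eq_leaf x t t.depth le_rfl] at h
  simp [brain, h]

end TreeWalk

/-! ### Conditions are countably many -/

/-- The graph of a condition: the finitely many decided strings with their values. [folklore] -/
def graph (σ : CohenCondition) : Finset (List Bool × Option Bool) :=
  σ.dom_finite.toFinset.image fun q => (q, σ.val q)

/-- The graph determines the condition. [folklore] -/
theorem graph_injective : Function.Injective graph := by
  have key : ∀ σ τ : CohenCondition, graph σ = graph τ → ∀ q ∈ σ.dom, τ.val q = σ.val q := by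
    intro σ τ h q hq
    have hm : (q, σ.val q) ∈ graph τ := by
      rw [← h]
      exact Finset.mem_image.2 ⟨q, (Set.Finite.mem_toFinset _).2 hq, rfl⟩
    obtain ⟨q', -, hq'⟩ := Finset.mem_image.1 hm
    obtain ⟨rfl, hv⟩ := Prod.mk.inj hq'
    exact hv
  intro σ τ h
  apply CohenCondition.ext'
  funext q
  by_cases hσ : q ∈ σ.dom
  · exact (key σ τ h q hσ).symm
  · by_cases hτ : q ∈ τ.dom
    · exact key τ σ h.symm q hτ
    · rw [mem_dom_iff, not_not] at hσ hτ
      rw [hσ, hτ]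

/-- Cohen conditions are countably many. [cite: FennerFortnowKurtzLi2003IC, §4 (p. 16, Cohen conditions are finite objects)] -/
instance instCountableCohenCondition : Countable CohenCondition :=
  graph_injective.countable

/-! ### Descriptions, tags, the padded payload -/

/-- An instance of the Standard Algorithm: a well-formed description together with the finite
condition over which it is (to be) categorical. [cite: FennerFortnowKurtzLi2003IC, §6.5 (p. 32: "given Mᵢ and σ")] -/
abbrev Descr : Type := ↥{Δ : AWPPDescr | Δ.WellFormed} × CohenCondition

/-- Descriptions are countably many (polynomial-time machines and conditions are).
[cite: FennerFortnowKurtzLi2003IC, Lemma 6.8 (p. 28, the enumeration Mᵢ)] -/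
instance instCountableDescr : Countable Descr := by
  haveI : Countable ↥{Δ : AWPPDescr | Δ.WellFormed} := FFKL.countable_wellFormed.to_subtype
  infer_instance

/-- An injective numbering of the descriptions. [folklore] -/
def tagNat : Descr → ℕ := Classical.choose (Countable.exists_injective_nat Descr)

/-- The numbering is injective. [folklore] -/
theorem tagNat_injective : Function.Injective tagNat := Classical.choose_spec (Countable.exists_injective_nat Descr)

/-- The tag of a description: its number in unary. [folklore] -/
def tagStr (t : Descr) : List Bool := ones (tagNat t)

/-- Tags are injective. [folklore] -/
theorem tagStr_injective : Function.Injective tagStr := fun t t' h =>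
  tagNat_injective (by simpa [tagStr, ones] using congrArg List.length h)

/-- The padding length `P(n)`: the polynomial bound `certDegPoly` on the reach `d(x)` of the
description on inputs of length `n`. [cite: FennerFortnowKurtzLi2003IC, Thm. 6.13 (p. 32, "a polynomial independent of σ")] -/
def padLen (t : Descr) (n : ℕ) : ℕ := t.1.1.certDegPoly.eval n

/-- **The payload** of the instance `x`: `⟨tag, ⟨x, 1^{P(|x|)}⟩⟩` — the tag names the description,
the pad pushes the protocol's questions above the reach of its machines.
[cite: Ko1989, §5 (p. 21: codes longer than the strings they may depend on)] -/
def pay (t : Descr) (x : List Bool) : List Bool := boolPair (tagStr t) (boolPair x (ones (padLen t x.length)))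

/-- The payload as an `FP` string function (fan-outs of a constant, the identity and a unary
polynomial pad). [cite: AroraBarakCC2009, §1.3] -/
def payFn (t : Descr) : List Bool → List Bool :=
  fanoutFn (fun _ => tagStr t) (fanoutFn id (Plumb.polyFn t.1.1.certDegPoly))

/-- The payload function computes the payload. [folklore] -/
@[simp] theorem payFn_apply (t : Descr) (x : List Bool) : payFn t x = pay t x := by
  simp [payFn, pay, padLen]

/-- The payload function is polynomial-time. [cite: AroraBarakCC2009, §1.3] -/
theorem payFn_mem_FP (t : Descr) : payFn t ∈ FP :=
  fanoutFn_mem_FP (const_mem_FP _) (fanoutFn_mem_FP OracleCompose.id_mem_FP (Plumb.polyFn_mem_FP _))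

/-- Payloads decode uniquely. [folklore] -/
theorem pay_inj {t t' : Descr} {x x' : List Bool} (h : pay t x = pay t' x') : t = t' ∧ x = x' := by
  obtain ⟨ht, hx⟩ := QCircuit.boolPair_inj h
  exact ⟨tagStr_injective ht, (QCircuit.boolPair_inj hx).1⟩

/-- **The truncation level** `W = P(|x|) + 1` of the instance: above the reach, below the length of
every question. [cite: Ko1989, §5 (p. 21)] -/
def lvl (t : Descr) (x : List Bool) : ℕ := padLen t x.length + 1

/-- Every question `⟨pay x, h⟩` is at least as long as the truncation level. [folklore] -/
theorem lvl_le_length_question (t : Descr) (x h : List Bool) : lvl t x ≤ (boolPair (pay t x) h).length := by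
  simp only [lvl, pay, length_boolPair, List.length_replicate, padLen, ones]
  omega

/-! ### The brain of an instance and the brain oracle `K` -/

section Instance

variable (Δ : AWPPDescr) (σ : CohenCondition) (x : List Bool)

/-- The string of a window variable (the enumeration `Finset.equivFin` of the window of `x` over
`σ`, as in `certPoint`). [cite: FennerFortnowKurtzLi2003IC, Thm. 6.13 (proof, p. 32)] -/
def str (i : Fin (Δ.certWindow σ x).card) : List Bool := ((Δ.certWindow σ x).equivFin.symm i).1

/-- Window strings are short: `|str i| < d(x)`. [cite: FennerFortnowKurtzLi2003IC, Thm. 6.13 (proof, p. 32)] -/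
theorem length_str_lt (i : Fin (Δ.certWindow σ x).card) : (str Δ σ x i).length < Δ.certDeg x :=
  (AWPPDescr.mem_certWindow.1 ((Δ.certWindow σ x).equivFin.symm i).2).1

/-- Probing `str i` in `G` answers the window point of `G` at `i`. [folklore] -/
theorem boolIndicator_str (G : Language Bool) (i : Fin (Δ.certWindow σ x).card) :
    G.boolIndicator (str Δ σ x i) = Δ.certPoint σ x G i := rfl

/-- **The decision tree of the instance** for the base `Kb`: Nisan's certificate search
(`CertificateAlgorithm.roundTree`, `bs(f)` rounds from empty knowledge) for the window function
`f = certFn Kb σ x`. [cite: BealsEtAl2001, Lemma 5.3] [cite: FennerFortnowKurtzLi2003IC, Fig. 1 (p. 29)] -/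
def tree (Kb : Language Bool) : DecisionTree (Δ.certWindow σ x).card :=
  CertificateAlgorithm.roundTree (Δ.certFn Kb σ x) (blockSensitivity (Δ.certFn Kb σ x)) fun _ => none

/-- **The brain of the instance** for the base `Kb`: walk its decision tree. [cite: FennerFortnowKurtzLi2003IC, Fig. 1 (p. 29)] -/
def plan (Kb : Language Bool) : List (List Bool × Bool) → Action :=
  TreeWalk.brain (str Δ σ x) (tree Δ σ x Kb)

end Instance

/-- `KHolds S u`: `u` is a question `⟨pay t x, h⟩` of the protocol machine of the description `t` on
input `x`, and the brain of the instance with base `S` truncated at the level of the instance,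
having parsed the history `h`, says `1`. [cite: FortnowRogers1999JCSS, proof of Thm. 4.2 (p. 7)] [cite: Ko1989, §5 (p. 21)] -/
def KHolds (S : Set (List Bool)) (u : List Bool) : Prop :=
  ∃ (t : Descr) (x h : List Bool), u = boolPair (pay t x) h ∧
    kbit (plan t.1.1 t.2 x (FRBrain.trunc S (lvl t x))) h = true

/-- **The brain oracle `K`**, built from the rule `KHolds` by recursion on length (`FRO.build`).
[cite: Ko1989, §5 (p. 21)] [cite: FortnowRogers1999JCSS, proof of Thm. 4.2 (p. 7)] -/
def oracleK : Set (List Bool) := FRO.build KHolds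

/-- Below the level, the stage language and `K` agree. [cite: Ko1989, §5 (p. 21)] -/
theorem trunc_belowB_eq {W n : ℕ} (h : W ≤ n) : FRBrain.trunc (FRO.belowB KHolds n) W = FRBrain.trunc oracleK W := by
  ext c
  simp only [FRBrain.trunc, Set.mem_setOf_eq, FRO.mem_belowB_iff]
  constructor
  · rintro ⟨⟨hc, -⟩, hl⟩; exact ⟨hc, hl⟩
  · rintro ⟨hc, hl⟩; exact ⟨⟨hc, lt_of_lt_of_le hl h⟩, hl⟩

/-- **`K` answers the protocol's questions**: on `⟨pay t x, h⟩` it says the bit of the brain of the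
instance with base `K` truncated at the level `W = P(|x|) + 1 ≤ |⟨pay t x, h⟩|`.
[cite: FortnowRogers1999JCSS, proof of Thm. 4.2 (p. 7)] [cite: Ko1989, §5 (p. 21)] -/
theorem mem_oracleK_question_iff (t : Descr) (x h : List Bool) :
    boolPair (pay t x) h ∈ oracleK ↔ kbit (plan t.1.1 t.2 x (FRBrain.trunc oracleK (lvl t x))) h = true := by
  change boolPair (pay t x) h ∈ FRO.build KHolds ↔ _
  rw [FRO.mem_build_iff]
  constructor
  · rintro ⟨t', x', h', hu, hk⟩
    obtain ⟨hp, hh⟩ := QCircuit.boolPair_inj hu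
    obtain ⟨rfl, rfl⟩ := pay_inj hp
    subst hh
    rwa [trunc_belowB_eq (lvl_le_length_question t x h)] at hk
  · intro hk
    exact ⟨t, x, h, rfl, by rwa [trunc_belowB_eq (lvl_le_length_question t x h)]⟩

/-! ### The protocol machine of a description decides its language -/

/-- The round budget in the padding polynomial `P`: `64 P⁶ (2P + 5) + 1` (depth `≤ 64 d⁶`, probes of
length `< d ≤ P`). [folklore] -/
def budget (P : Polynomial ℕ) : Polynomial ℕ := 64 * P ^ 6 * (2 * P + 5) + 1

/-- Evaluation of the budget. [folklore] -/
theorem budget_eval (P : Polynomial ℕ) (n : ℕ) :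
    (budget P).eval n = 64 * P.eval n ^ 6 * (2 * P.eval n + 5) + 1 := by
  simp [budget]

/-- **The protocol machine of `t = (Δ, σ)` decides `L(Δ^{K ⊕ G})`** for `Δ` categorical over `σ`
(base `K`) and `G` extending `σ`: `x ∈ L(Δ^{K ⊕ G}) ↔ x ∈ protoLang (payFn t) (budget P) K G`. The
brain's base `K_{<W}` is as good as `K` for the machines of `Δ` on the witnesses of `x`
(`certFn_congr_base`); the brain walks the certificate-search tree of the window function
`f = certFn K σ x`, probing window strings of `G` (answered by the window point of `G`), and halts
after `depth ≤ bs(f)·C(f) ≤ 64 d(x)⁶` probes (Thm. 6.13) with the verdict `f(G|window) = [x ∈ L]`.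
[cite: FennerFortnowKurtzLi2003IC, Lemma 6.9, Thm. 6.13, Lemma 6.16 (pp. 29–33)] [cite: FortnowRogers1999JCSS, Thm. 3.6 and proof of Thm. 4.2 (pp. 5, 7)] -/
theorem mem_lang_iff_mem_protoLang (t : Descr) (hcat : t.1.1.Categorical oracleK t.2) {G : Language Bool}
    (hG : t.2.ExtendedBy G) (x : List Bool) :
    x ∈ t.1.1.lang oracleK G ↔ x ∈ protoLang (payFn t) (budget t.1.1.certDegPoly) oracleK G := by
  obtain ⟨⟨Δ, hwf⟩, σ⟩ := t
  change Δ.WellFormed at hwf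
  change Δ.Categorical oracleK σ at hcat
  change σ.ExtendedBy G at hG
  change x ∈ Δ.lang oracleK G ↔ x ∈ protoLang (payFn (⟨Δ, hwf⟩, σ)) (budget Δ.certDegPoly) oracleK G
  -- the padding bound and the base truncation
  have hd : Δ.certDeg x ≤ Δ.certDegPoly.eval x.length := Δ.certDeg_le_eval_certDegPoly x
  have hKb : Δ.certFn (FRBrain.trunc oracleK (lvl (⟨Δ, hwf⟩, σ) x)) σ x = Δ.certFn oracleK σ x := by
    refine AWPPDescr.certFn_congr_base hwf σ x fun c hc => ⟨fun h => h.1, fun h => ⟨h, ?_⟩⟩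
    change c.length < Δ.certDegPoly.eval x.length + 1
    omega
  -- the brain walks the certificate-search tree of the window function for the base `K`
  set f := Δ.certFn oracleK σ x with hf
  set T : DecisionTree (Δ.certWindow σ x).card :=
    CertificateAlgorithm.roundTree f (blockSensitivity f) fun _ => none with hT
  have hplan : plan Δ σ x (FRBrain.trunc oracleK (lvl (⟨Δ, hwf⟩, σ) x)) = TreeWalk.brain (str Δ σ x) T := by
    unfold plan tree
    rw [hKb]
  -- `K` answers the questions of the instance
  have hK : ∀ h : List Bool, boolPair (payFn (⟨Δ, hwf⟩, σ) x) h ∈ oracleK ↔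
      kbit (TreeWalk.brain (str Δ σ x) T) h = true := by
    intro h
    rw [payFn_apply, mem_oracleK_question_iff, ← hplan]
  -- the canonical run halts after `depth` probes with the value of the tree on the window point of `G`
  set x₀ := Δ.certPoint σ x G with hx₀
  have hg : ∀ i, G.boolIndicator (str Δ σ x i) = x₀ i := fun i => rfl
  have hhalt := TreeWalk.brain_halts (str Δ σ x) T hg
  have heval : T.eval x₀ = f x₀ :=
    CertificateAlgorithm.eval_roundTree f _ _ x₀ (CertificateAlgorithm.consistent_none x₀)
      (CertificateAlgorithm.roundInv_blockSensitivity f)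
  -- depth bound (Thm. 6.13: `bs(f) ≤ 4d²`, `C(f) ≤ 16d⁴`)
  have hdepth : T.depth ≤ 64 * Δ.certDegPoly.eval x.length ^ 6 :=
    calc T.depth ≤ blockSensitivity f * oneCertificateComplexity f := CertificateAlgorithm.depth_roundTree_le f _ _
      _ ≤ (4 * Δ.certDeg x ^ 2) * (16 * Δ.certDeg x ^ 4) :=
          Nat.mul_le_mul (AWPPDescr.blockSensitivity_certFn_le hcat x)
            ((oneCertificateComplexity_le f).trans (AWPPDescr.certificateComplexity_certFn_le hcat x))
      _ = 64 * Δ.certDeg x ^ 6 := by ring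
      _ ≤ 64 * Δ.certDegPoly.eval x.length ^ 6 := by gcongr
  -- probes are window strings, of length `< d ≤ P`
  have hlen : ∀ J' z, TreeWalk.brain (str Δ σ x) T (results (TreeWalk.brain (str Δ σ x) T) G.boolIndicator J') =
      .probe z → z.length ≤ Δ.certDegPoly.eval x.length := by
    intro J' z h
    obtain ⟨i, rfl⟩ := TreeWalk.exists_eq_str_of_brain_eq_probe (str Δ σ x) T h
    exact ((length_str_lt Δ σ x i).le.trans hd)
  have hq : T.depth * (2 * Δ.certDegPoly.eval x.length + 5) < (budget Δ.certDegPoly).eval x.length := by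
    rw [budget_eval]
    exact Nat.lt_succ_of_le (Nat.mul_le_mul_right _ hdepth)
  rw [mem_protoLang_iff_of_le (plan := TreeWalk.brain (str Δ σ x) T) hK hhalt hlen hq, heval,
    AWPPDescr.mem_lang_iff_certFn (B := oracleK) hwf hG x]

/-- **The language of a categorical description is in `P^{K ⊕ G}`**: it is the protocol language of
its payload, and protocol languages are in `P^{K ⊕ G}` (`protoLang_mem_PRel`).
[cite: FennerFortnowKurtzLi2003IC, Lemma 6.16 (p. 33)] [cite: FortnowRogers1999JCSS, proof of Thm. 4.2 (p. 7)] -/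
theorem lang_mem_PRel (t : Descr) (hcat : t.1.1.Categorical oracleK t.2) {G : Language Bool} (hG : t.2.ExtendedBy G) :
    t.1.1.lang oracleK G ∈ PRel (Oracle.ofLanguage (oracleJoin oracleK G)) := by
  have h : t.1.1.lang oracleK G = protoLang (payFn t) (budget t.1.1.certDegPoly) oracleK G :=
    Set.ext fun x => mem_lang_iff_mem_protoLang t hcat hG x
  rw [h, ← joinLang_eq_oracleJoin]
  exact protoLang_mem_PRel (payFn_mem_FP t) _ _ _

/-- **The Standard-Algorithm hypothesis of `FFKLGenericCollapse.lean` holds for the base `K`**: for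
every well-formed description categorical over a finite condition `σ` and every `G` extending `σ`,
`L(Δ^{K ⊕ G}) ∈ P^{K ⊕ G}` — the brain supplies what `F_j ∈ FPSPACE` supplies in print.
[cite: FennerFortnowKurtzLi2003IC, Lemma 6.16, Lemma 6.17 and Thm. 6.18 (2) (p. 33)] [cite: FortnowRogers1999JCSS, Thm. 3.6 (p. 5)] -/
theorem stdAlg_oracleK : ∀ Δ : AWPPDescr, Δ.WellFormed → ∀ σ : CohenCondition, Δ.Categorical oracleK σ →
    ∀ G : Language Bool, σ.ExtendedBy G → Δ.lang oracleK G ∈ PRel (Oracle.ofLanguage (oracleJoin oracleK G)) :=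
  fun Δ hwf σ hcat _ hG => lang_mem_PRel (⟨Δ, hwf⟩, σ) hcat hG

/-! ### The world `K ⊕ G` and Cor. 3.7 -/

/-- **The oracle-existence step of Cor. 3.7, proved**: some `G` (Cohen generic for the union of the
collapse family `FFKL.family K` and the hierarchy family of `K`, through the empty condition) has
`P^{K ⊕ G} = AWPP^{K ⊕ G}` and `PH^{K ⊕ G}` infinite. [cite: FortnowRogers1999JCSS, §3, proof of Cor. 3.7 (p. 5: "joining a generic G")] [cite: FennerFortnowKurtzLi2003IC, Thm. 6.18 (2) (p. 33) and §1 (p. 3)] -/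
theorem exists_generic_world : ∃ G : Language Bool,
    PRel (Oracle.ofLanguage (oracleJoin oracleK G)) = AWPPRel (Oracle.ofLanguage (oracleJoin oracleK G)) ∧
      IsInfinitePHRel (Oracle.ofLanguage (oracleJoin oracleK G)) := by
  obtain ⟨𝒮, h𝒮, hPH⟩ := isInfinitePHRel_join_generic_holds oracleK
  obtain ⟨G, -, hG⟩ := exists_extendedBy_isGeneric ((FFKL.family_countable oracleK).union h𝒮) (⊥ : CohenCondition)
  exact ⟨G, FFKL.PRel_eq_AWPPRel_of_isGeneric_of_stdAlg stdAlg_oracleK (isGeneric_union.1 hG).1,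
    hPH G (isGeneric_union.1 hG).2⟩

/-- The same as the hypothesis `h₃` of the tree's assemblies: `∃ A, P^A = AWPP^A ∧ PH^A` infinite.
[cite: FortnowRogers1999JCSS, §3, proof of Cor. 3.7 (p. 5)] -/
theorem exists_oracle_PRel_eq_AWPPRel_infinitePH : ∃ A : Language Bool,
    PRel (Oracle.ofLanguage A) = AWPPRel (Oracle.ofLanguage A) ∧ IsInfinitePHRel (Oracle.ofLanguage A) := by
  obtain ⟨G, hPA, hPH⟩ := exists_generic_world
  exact ⟨oracleJoin oracleK G, hPA, hPH⟩

/-- **`P^{K ⊕ G} = BQP^{K ⊕ G}` with `PH^{K ⊕ G}` infinite** for the world of `exists_generic_world`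
(`P ⊆ BPP ⊆ BQP ⊆ AWPP = P`, all inclusions proved in the tree). [cite: FortnowRogers1999JCSS, Cor. 3.7 and Thm. 3.1 (p. 5)] -/
theorem PRel_eq_BQPRel_infinitePH : ∃ G : Language Bool,
    PRel (Oracle.ofLanguage (oracleJoin oracleK G)) = BQPRel (oracleJoin oracleK G) ∧
      IsInfinitePHRel (Oracle.ofLanguage (oracleJoin oracleK G)) := by
  obtain ⟨G, hPA, hPH⟩ := exists_generic_world
  refine ⟨G, Set.Subset.antisymm ?_ ?_, hPH⟩
  · exact PRel_ofLanguage_subset_BQPRel_of_BPPRel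
      (BPPRel_ofLanguage_subset_BQPRel_of_sim uniformOracleCoinSimulation_holds) PRel_subset_BPPRel_holds _
  · rw [hPA]
    exact BQPRel_subset_AWPPRel_holds _

end Cor37Brain

/-- **Fortnow–Rogers 1999, Cor. 3.7 — DISCHARGED**: "There exists a relativized world where `P = BQP`
and the polynomial-time hierarchy is infinite." The world is `K ⊕ G` — the brain oracle `K` of
`Cor37Brain.oracleK` joined with a Cohen generic `G` — in place of the printed `H ⊕ G` with `H`
`PSPACE`-complete; the architecture of the printed proof is kept (`BQP^A ⊆ AWPP^A` relativized,
Fenner–Fortnow–Kurtz–Li's generic collapse of `AWPP` to `P` by the Standard Algorithm, the hierarchy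
being infinite relative to generics), the brain supplying the certificate search that a
`PSPACE`-complete set supplies in print (`fortnowRogers1999_cor37_of_parts` fed with the discharged
leaves and `Cor37Brain.exists_oracle_PRel_eq_AWPPRel_infinitePH`).
[cite: FortnowRogers1999JCSS, Cor. 3.7 and its proof, §3 p. 5 (arXiv numbering)] [cite: FennerFortnowKurtzLi2003IC, Fig. 1, Lemma 6.16 and Thm. 6.18 (2) (pp. 29–33)] -/
theorem fortnowRogers1999_cor37_holds : fortnowRogers1999_cor37 :=
  fortnowRogers1999_cor37_of_parts (BPPRel_ofLanguage_subset_BQPRel_of_sim uniformOracleCoinSimulation_holds)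
    BQPRel_subset_AWPPRel_holds Cor37Brain.exists_oracle_PRel_eq_AWPPRel_infinitePH

end Literature.Barriers.QuantumAdvantage

end
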